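import Summits.AtomisticToContinuum.FouriersLaw.Theses.EmbeddedDrudeMourre
import Summits.AtomisticToContinuum.FouriersLaw.Theorems.EmbeddedDrudeMourreDrudeDissolutionStubHarmonicSteinSchwingerDyson
import Summits.AtomisticToContinuum.FouriersLaw.Theorems.EmbeddedDrudeMourreDrudeDissolutionStubHarmonicSteinGreen
import Literature.MathematicalPhysics.KineticTheory.HarmonicChaosDecomposition
import Literature.MathematicalPhysics.KineticTheory.ZeroWavenumberSpace
import Literature.MathematicalPhysics.KineticTheory.InfiniteChainInvariantStates
import Literature.MathematicalPhysics.KineticTheory.InfiniteChainSuperstableDynamics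
import Literature.MathematicalPhysics.KineticTheory.InfiniteChainGoodSetSymmetries
import HarnessLib

/-!
# Stub K1 `stub_harmonicStein`: Stein/Isserlis recursion for the harmonic thermal state
(line `gram-pencil-harmonic-chaos`, crux `EmbeddedDrudeMourre.DrudeDissolution`,
item stmt-AtomisticToContinuum-12593; `--supports` file, closes nothing)

WHAT. For `ω₂ > 0`, `T > 0` and ANY shift-invariant DLR state `μ` of the HARMONIC chain
`pinnedChain ω₂ 0 0 γ` (`U = ω₂q²/2`, `V = r²/2`) at temperature `T`, the linear local observables
`φ(f) = Σ_x (f^q_x q_x + f^p_x p_x)` (`HarmonicChaos.linObs`) satisfy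
(i) every product `∏ᵢ φ(fᵢ)` is `μ`-integrable; (ii) `∫ φ(f₀) dμ = 0`;
(iii) STEIN'S RECURSION `∫ φ(f₀) ∏ᵢ φ(fᵢ) dμ = Σᵢ C_T(f₀, fᵢ) ∫ ∏_{j ≠ i} φ(f_j) dμ` with the thermal
covariance `C_T = HarmonicChaos.thermalCov ω₂ T` (`T·G(x − y)` between `q_x, q_y`,
`G = HarmonicChaos.greenFn ω₂` the lattice Green function of `ω₂ − Δ`; `T δ_{xy}` between
`p_x, p_y`; `0` between positions and momenta) — i.e. all mixed moments of the coordinates are the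
Isserlis–Wick moments of the centred Gaussian field with covariance `C_T`. No Gaussian measure, no
transfer operator and no identification of `μ` is used.

HOW (Schwinger–Dyson + one-site DLR + bounded uniqueness).
* Integrability and the MOMENTUM letters (`∫ p_x Π = T Σᵢ f_i^p(x) Eᵢ`, `Eᵢ = ∫ ∏_{j≠i} φ_j`) and
  the SCHWINGER–DYSON identity `∫ F_x Π = −T Σᵢ f_i^q(x) Eᵢ` are in the helper file
  `…StubHarmonicSteinSchwingerDyson` (one-site DLR factorisation; stub S).
* POSITIONS (`integral_fst_mul_prod_linObs`): the force is HARMONIC,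
  `F_x = −((ω₂+2)q_x − q_{x+1} − q_{x−1})`, so `M(x) = ∫ q_x Π` solves
  `(ω₂+2)M(x) − M(x+1) − M(x−1) = T Σᵢ f_i^q(x) Eᵢ`; the Gaussian side
  `W(x) = T Σᵢ (Σ_y f_i^q(y) G(x−y)) Eᵢ` solves the same equation because `(ω₂ − Δ)G = δ₀`
  (`greenFn_harmonic_identity` of the sibling file `…StubHarmonicPencilAlgebraGreen`); `M − W` is
  bounded in `x` (`|q_xΠ| ≤ q_x² + Π²` and shift invariance; `|G| ≤ 1/ω₂`, helper
  `abs_greenFn_le`), and a bounded solution of `(ω₂ − Δ)d = 0` vanishes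
  (helper `eq_zero_of_bounded_of_lattice_eq`). Hence `M = W`.
* Linearity in `f₀` over its letters `q_x`, `p_x` assembles (iii) (`integral_linObs_mul_prod_linObs`,
  finset form); (ii) is the empty product; `Fin.removeNth` is the `Finset.univ.erase` product.
-/

noncomputable section

namespace Summit.AtomisticToContinuum.FouriersLaw.Theorems.DrudeDissolution.GramPencilHarmonicChaos

open MeasureTheory Filter Set Function Topology
open scoped InnerProductSpace ENNReal ComplexConjugate
open Literature.MathematicalPhysics.KineticTheory
open Literature.MathematicalPhysics.KineticTheory.HeatConduction
open Literature.MathematicalPhysics.KineticTheory.PhononBoltzmann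
open HarmonicChaos ProbabilityTheory
open PinnedChainKinetic (𝕋 𝕋3 μ𝕋 μ𝕋3 k₄ sinT)
open scoped Literature.MathematicalPhysics.KineticTheory.HeatConduction.PinnedChainKinetic

/-! ## The position letters: lattice equation, boundedness, uniqueness -/

section AssemblyQ

/-- **The harmonic force**: `F_x = −((ω₂ + 2) q_x − q_{x+1} − q_{x−1})` for `pinnedChain ω₂ 0 0 γ`.
[folklore] -/
theorem force_pinnedChain_harmonic (ω₂ γ : ℝ) (σ : ChainConfig) (x : ℤ) :
    (pinnedChain ω₂ 0 0 γ).force σ x = -((ω₂ + 2) * (σ x).1 - (σ (x + 1)).1 - (σ (x - 1)).1) := by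
  rw [OscillatorChain.force_eq, pinnedChain_deriv_U, pinnedChain_deriv_V, pinnedChain_deriv_V]
  ring

variable {ω₂ γ T : ℝ} {μ : Measure ChainConfig}

/-- **Shift invariance of the position variances**: `∫ q_z² dμ = ∫ q_0² dμ`. [folklore] -/
theorem integral_fst_sq_eq (hS : IsShiftInvariant μ) (z : ℤ) :
    ∫ σ, (σ z).1 ^ 2 ∂μ = ∫ σ, (σ 0).1 ^ 2 ∂μ := by
  have hmp := hS.measurePreserving_chainShift z
  have hg : Measurable fun σ : ChainConfig => (σ 0).1 ^ 2 := ((measurable_pi_apply 0).fst).pow_const 2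
  have h := integral_map hmp.measurable.aemeasurable
    (hg.aestronglyMeasurable (μ := μ.map (chainShift z)))
  rw [hmp.map_eq] at h
  rw [h]
  simp [chainShift_apply]

/-- **The position moments are bounded in the site**: `|∫ q_z Π dμ| ≤ ∫ q_0² dμ + ∫ Π² dμ` for a
local polynomial `Π` (`|ab| ≤ a² + b²` and shift invariance). [folklore] -/
theorem abs_integral_fst_mul_le (hω : 0 < ω₂) (hT : 0 < T)
    (hμ : (pinnedChain ω₂ 0 0 γ).IsChainGibbsMeasure T μ) (hS : IsShiftInvariant μ)
    {H : ChainConfig → ℝ} (hH : H ∈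
        (Algebra.adjoin ℝ (Set.range (fun xc : ℤ × Bool => fun σ : ChainConfig => if xc.2 then (σ xc.1).2 else (σ xc.1).1)))) (z : ℤ) :
    |∫ σ, (σ z).1 * H σ ∂μ| ≤ ∫ σ, (σ 0).1 ^ 2 ∂μ + ∫ σ, H σ ^ 2 ∂μ := by
  have hq2 : (fun σ : ChainConfig => (σ z).1 ^ 2) ∈
      (Algebra.adjoin ℝ (Set.range (fun xc : ℤ × Bool => fun σ : ChainConfig => if xc.2 then (σ xc.1).2 else (σ xc.1).1))) := by
    have : (fun σ : ChainConfig => (σ z).1 ^ 2) = fun σ => (σ z).1 * (σ z).1 := funext fun σ => sq _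
    rw [this]; exact mul_mem_localPolynomials (position_mem_localPolynomials z) (position_mem_localPolynomials z)
  have hH2 : (fun σ : ChainConfig => H σ ^ 2) ∈
      (Algebra.adjoin ℝ (Set.range (fun xc : ℤ × Bool => fun σ : ChainConfig => if xc.2 then (σ xc.1).2 else (σ xc.1).1))) := by
    have : (fun σ : ChainConfig => H σ ^ 2) = fun σ => H σ * H σ := funext fun σ => sq _
    rw [this]; exact mul_mem_localPolynomials hH hH
  have hqH : (fun σ : ChainConfig => (σ z).1 * H σ) ∈
      (Algebra.adjoin ℝ (Set.range (fun xc : ℤ × Bool => fun σ : ChainConfig => if xc.2 then (σ xc.1).2 else (σ xc.1).1))) :=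
    mul_mem_localPolynomials (position_mem_localPolynomials z) hH
  calc |∫ σ, (σ z).1 * H σ ∂μ| ≤ ∫ σ, |(σ z).1 * H σ| ∂μ := abs_integral_le_integral_abs
    _ ≤ ∫ σ, ((σ z).1 ^ 2 + H σ ^ 2) ∂μ := by
        refine integral_mono (integrable_of_mem_localPolynomials hω hT hμ hS hqH).abs
          ((integrable_of_mem_localPolynomials hω hT hμ hS hq2).add
            (integrable_of_mem_localPolynomials hω hT hμ hS hH2)) fun σ => ?_
        -- `|ab| ≤ a² + b²`
        show |(σ z).1 * H σ| ≤ (σ z).1 ^ 2 + H σ ^ 2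
        rw [abs_mul]
        nlinarith [sq_nonneg (|(σ z).1| - |H σ|), abs_nonneg (σ z).1, abs_nonneg (H σ),
          sq_abs (σ z).1, sq_abs (H σ), mul_nonneg (abs_nonneg (σ z).1) (abs_nonneg (H σ))]
    _ = ∫ σ, (σ 0).1 ^ 2 ∂μ + ∫ σ, H σ ^ 2 ∂μ := by
        rw [integral_add (integrable_of_mem_localPolynomials hω hT hμ hS hq2)
          (integrable_of_mem_localPolynomials hω hT hμ hS hH2), integral_fst_sq_eq hS z]

/-- **The lattice equation of the position moments**: for `M(z) = ∫ q_z Π dμ`,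
`(ω₂ + 2) M(z) − M(z+1) − M(z−1) = −∫ F_z Π dμ = T Σᵢ f_i^q(z) Eᵢ` (harmonic force + Schwinger–Dyson).
[cite: LanfordLebowitzLieb1977, §4 remark (i)] -/
theorem lattice_eq_integral_fst_mul_prod (hω : 0 < ω₂) (hT : 0 < T)
    (hμ : (pinnedChain ω₂ 0 0 γ).IsChainGibbsMeasure T μ) (hS : IsShiftInvariant μ)
    (z : ℤ) {ι : Type} [DecidableEq ι] (u : Finset ι) (f : ι → TestFn) :
    (ω₂ + 2) * (∫ σ, (σ z).1 * ∏ i ∈ u, linObs (f i) σ ∂μ) -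
        (∫ σ, (σ (z + 1)).1 * ∏ i ∈ u, linObs (f i) σ ∂μ) -
        (∫ σ, (σ (z - 1)).1 * ∏ i ∈ u, linObs (f i) σ ∂μ) =
      T * ∑ i ∈ u, (f i).1 z * ∫ σ, ∏ j ∈ u.erase i, linObs (f j) σ ∂μ := by
  have hE := integral_force_mul_prod_linObs hω hT hμ hS z u f
  have hPi : (fun σ : ChainConfig => ∏ i ∈ u, linObs (f i) σ) ∈
      (Algebra.adjoin ℝ (Set.range (fun xc : ℤ × Bool => fun σ : ChainConfig => if xc.2 then (σ xc.1).2 else (σ xc.1).1))) := prod_linObs_mem_localPolynomials u f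
  have hI : ∀ w : ℤ, Integrable (fun σ : ChainConfig => (σ w).1 * ∏ i ∈ u, linObs (f i) σ) μ := fun w =>
    integrable_of_mem_localPolynomials hω hT hμ hS (mul_mem_localPolynomials (position_mem_localPolynomials w) hPi)
  have hF : ∀ σ : ChainConfig, (pinnedChain ω₂ 0 0 γ).force σ z * ∏ i ∈ u, linObs (f i) σ =
      -((ω₂ + 2) * ((σ z).1 * ∏ i ∈ u, linObs (f i) σ) - (σ (z + 1)).1 * ∏ i ∈ u, linObs (f i) σ -
        (σ (z - 1)).1 * ∏ i ∈ u, linObs (f i) σ) := by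
    intro σ; rw [force_pinnedChain_harmonic]; ring
  simp_rw [hF] at hE
  rw [integral_neg, integral_sub, integral_sub, integral_const_mul] at hE
  · linarith
  all_goals
    first
    | exact ((hI z).const_mul _).sub (hI _)
    | exact (hI z).const_mul _
    | exact hI _

/-- **The lattice equation of the Gaussian side**: for `W(z) = T Σᵢ (Σ_y f_i^q(y) G(z − y)) Eᵢ`,
`(ω₂ + 2) W(z) − W(z+1) − W(z−1) = T Σᵢ f_i^q(z) Eᵢ` (`(ω₂ − Δ) G = δ₀`). [folklore] -/
theorem lattice_eq_green_side (hω : 0 < ω₂) (T : ℝ) (z : ℤ) {ι : Type} (u : Finset ι)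
    (f : ι → TestFn) (E : ι → ℝ) :
    (ω₂ + 2) * (T * ∑ i ∈ u, (∑ y ∈ (f i).1.support, (f i).1 y * greenFn ω₂ (z - y)) * E i) -
        T * ∑ i ∈ u, (∑ y ∈ (f i).1.support, (f i).1 y * greenFn ω₂ (z + 1 - y)) * E i -
        T * ∑ i ∈ u, (∑ y ∈ (f i).1.support, (f i).1 y * greenFn ω₂ (z - 1 - y)) * E i =
      T * ∑ i ∈ u, (f i).1 z * E i := by
  have hA : ∀ i, (ω₂ + 2) * (∑ y ∈ (f i).1.support, (f i).1 y * greenFn ω₂ (z - y)) -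
      (∑ y ∈ (f i).1.support, (f i).1 y * greenFn ω₂ (z + 1 - y)) -
      (∑ y ∈ (f i).1.support, (f i).1 y * greenFn ω₂ (z - 1 - y)) = (f i).1 z := by
    intro i
    rw [Finset.mul_sum, ← Finset.sum_sub_distrib, ← Finset.sum_sub_distrib]
    have h : ∀ y ∈ (f i).1.support, (ω₂ + 2) * ((f i).1 y * greenFn ω₂ (z - y)) -
        (f i).1 y * greenFn ω₂ (z + 1 - y) - (f i).1 y * greenFn ω₂ (z - 1 - y) =
        if y = z then (f i).1 y else 0 := by
      intro y _
      have hg := greenFn_harmonic_identity hω (z - y)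
      rw [show z + 1 - y = z - y + 1 by ring, show z - 1 - y = z - y - 1 by ring,
        show (ω₂ + 2) * ((f i).1 y * greenFn ω₂ (z - y)) - (f i).1 y * greenFn ω₂ (z - y + 1) -
          (f i).1 y * greenFn ω₂ (z - y - 1) =
          (f i).1 y * ((ω₂ + 2) * greenFn ω₂ (z - y) - greenFn ω₂ (z - y + 1) - greenFn ω₂ (z - y - 1)) by ring,
        hg]
      by_cases hyz : y = z
      · subst hyz; simp
      · rw [if_neg (sub_ne_zero.2 (Ne.symm hyz)), if_neg hyz, mul_zero]
    rw [Finset.sum_congr rfl h, Finset.sum_ite_eq']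
    by_cases hz : z ∈ (f i).1.support
    · rw [if_pos hz]
    · rw [if_neg hz, Finsupp.notMem_support_iff.1 hz]
  rw [← mul_assoc, mul_comm (ω₂ + 2) T, mul_assoc, ← mul_sub, ← mul_sub, Finset.mul_sum,
    ← Finset.sum_sub_distrib, ← Finset.sum_sub_distrib]
  congr 1
  refine Finset.sum_congr rfl fun i _ => ?_
  rw [← hA i]
  ring

/-- **Stein's identity for a position letter**:
`∫ q_x ∏ᵢ φ(fᵢ) dμ = T Σᵢ (Σ_y f_i^q(y) G(x − y)) ∫ ∏_{j ≠ i} φ(f_j) dμ` — both sides solve the same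
lattice equation in `x` and their difference is bounded, hence zero (no bounded lattice mode for
`ω₂ > 0`). [cite: LanfordLebowitzLieb1977, §4 remark (ii)] -/
theorem integral_fst_mul_prod_linObs (hω : 0 < ω₂) (hT : 0 < T)
    (hμ : (pinnedChain ω₂ 0 0 γ).IsChainGibbsMeasure T μ) (hS : IsShiftInvariant μ)
    (x : ℤ) {ι : Type} [DecidableEq ι] (u : Finset ι) (f : ι → TestFn) :
    ∫ σ, (σ x).1 * ∏ i ∈ u, linObs (f i) σ ∂μ =
      T * ∑ i ∈ u, (∑ y ∈ (f i).1.support, (f i).1 y * greenFn ω₂ (x - y)) *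
        ∫ σ, ∏ j ∈ u.erase i, linObs (f j) σ ∂μ := by
  -- the difference of the two sides as a function of the site
  set E : ι → ℝ := fun i => ∫ σ, ∏ j ∈ u.erase i, linObs (f j) σ ∂μ with hEdef
  set d : ℤ → ℝ := fun z => (∫ σ, (σ z).1 * ∏ i ∈ u, linObs (f i) σ ∂μ) -
    T * ∑ i ∈ u, (∑ y ∈ (f i).1.support, (f i).1 y * greenFn ω₂ (z - y)) * E i with hddef
  suffices h : d x = 0 by
    have h' := h
    simp only [hddef] at h'
    exact sub_eq_zero.1 h'
  -- boundedness
  have hPi : (fun σ : ChainConfig => ∏ i ∈ u, linObs (f i) σ) ∈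
      (Algebra.adjoin ℝ (Set.range (fun xc : ℤ × Bool => fun σ : ChainConfig => if xc.2 then (σ xc.1).2 else (σ xc.1).1))) := prod_linObs_mem_localPolynomials u f
  set C₁ : ℝ := ∫ σ, (σ 0).1 ^ 2 ∂μ + ∫ σ, (∏ i ∈ u, linObs (f i) σ) ^ 2 ∂μ with hC₁
  set C₂ : ℝ := |T| * ∑ i ∈ u, (∑ y ∈ (f i).1.support, |(f i).1 y| * (1 / ω₂)) * |E i| with hC₂
  have hB : ∀ z, |d z| ≤ C₁ + C₂ := by
    intro z
    have h1 : |∫ σ, (σ z).1 * ∏ i ∈ u, linObs (f i) σ ∂μ| ≤ C₁ :=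
      abs_integral_fst_mul_le hω hT hμ hS hPi z
    have h2 : |T * ∑ i ∈ u, (∑ y ∈ (f i).1.support, (f i).1 y * greenFn ω₂ (z - y)) * E i| ≤ C₂ := by
      rw [abs_mul, hC₂]
      refine mul_le_mul_of_nonneg_left ((Finset.abs_sum_le_sum_abs _ _).trans
        (Finset.sum_le_sum fun i _ => ?_)) (abs_nonneg T)
      rw [abs_mul]
      refine mul_le_mul_of_nonneg_right ((Finset.abs_sum_le_sum_abs _ _).trans
        (Finset.sum_le_sum fun y _ => ?_)) (abs_nonneg _)
      rw [abs_mul]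
      exact mul_le_mul_of_nonneg_left (abs_greenFn_le hω _) (abs_nonneg _)
    calc |d z| ≤ |∫ σ, (σ z).1 * ∏ i ∈ u, linObs (f i) σ ∂μ| +
        |T * ∑ i ∈ u, (∑ y ∈ (f i).1.support, (f i).1 y * greenFn ω₂ (z - y)) * E i| := abs_sub _ _
      _ ≤ C₁ + C₂ := add_le_add h1 h2
  -- the homogeneous lattice equation
  have hlat : ∀ z, (ω₂ + 2) * d z - d (z + 1) - d (z - 1) = 0 := by
    intro z
    have hM := lattice_eq_integral_fst_mul_prod hω hT hμ hS z u f
    have hW := lattice_eq_green_side hω T z u f E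
    simp only [hddef]
    linarith
  exact eq_zero_of_bounded_of_lattice_eq hω d (C₁ + C₂) hB hlat x

end AssemblyQ

/-! ## Linearity in the distinguished observable; the registered stub -/

section AssemblyFinal

/-- The thermal covariance expanded over the supports of the first argument:
`C_T(f₀, g) = Σ_x f₀^q_x · (T Σ_y g^q_y G(x − y)) + Σ_x f₀^p_x · (T g^p_x)`.
[cite: LanfordLebowitzLieb1977, §4 remark (ii)] -/
theorem thermalCov_eq_sum (ω₂ T : ℝ) (f₀ g : TestFn) :
    thermalCov ω₂ T f₀ g =
      ∑ x ∈ f₀.1.support, f₀.1 x * (T * ∑ y ∈ g.1.support, g.1 y * greenFn ω₂ (x - y)) +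
        ∑ x ∈ f₀.2.support, f₀.2 x * (T * g.2 x) := by
  unfold thermalCov
  simp only [Finsupp.sum]
  rw [mul_add, Finset.mul_sum, Finset.mul_sum]
  congr 1
  · refine Finset.sum_congr rfl fun x _ => ?_
    rw [Finset.mul_sum, Finset.mul_sum, Finset.mul_sum]
    refine Finset.sum_congr rfl fun y _ => ?_
    ring
  · refine Finset.sum_congr rfl fun x _ => ?_
    ring

/-- Bookkeeping: regrouping the letter expansion by the factor index. [folklore] -/
theorem sum_letters_regroup {ι : Type*} (u : Finset ι) (sa sb : Finset ℤ) (a b : ℤ → ℝ)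
    (A B : ℤ → ι → ℝ) (E : ι → ℝ) (T : ℝ) :
    ∑ x ∈ sa, a x * (T * ∑ i ∈ u, A x i * E i) + ∑ x ∈ sb, b x * (T * ∑ i ∈ u, B x i * E i) =
      ∑ i ∈ u, (∑ x ∈ sa, a x * (T * A x i) + ∑ x ∈ sb, b x * (T * B x i)) * E i := by
  simp only [add_mul, Finset.sum_add_distrib, Finset.sum_mul, Finset.mul_sum]
  congr 1
  · rw [Finset.sum_comm]
    refine Finset.sum_congr rfl fun i _ => Finset.sum_congr rfl fun x _ => ?_
    ring
  · rw [Finset.sum_comm]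
    refine Finset.sum_congr rfl fun i _ => Finset.sum_congr rfl fun x _ => ?_
    ring

/-- `∏_{j ≠ i} g_j = ∏_{j : Fin N} g_{i.succAbove j}` on `Fin (N + 1)`. [folklore] -/
theorem prod_univ_erase_eq_prod_succAbove {M : Type*} [CommMonoid M] {N : ℕ} (g : Fin (N + 1) → M)
    (i : Fin (N + 1)) :
    ∏ j ∈ Finset.univ.erase i, g j = ∏ j : Fin N, g (i.succAbove j) := by
  have h : (Finset.univ : Finset (Fin (N + 1))).erase i = Finset.univ.image i.succAbove := by
    rw [Fin.image_succAbove_univ]; ext j; simp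
  rw [h, Finset.prod_image fun a _ b _ hab => Fin.succAbove_right_injective hab]

variable {ω₂ γ T : ℝ} {μ : Measure ChainConfig}

/-- **Stein's recursion for products of linear observables (finset form).** For every shift-invariant
DLR state `μ` of the harmonic chain `pinnedChain ω₂ 0 0 γ` at temperature `T`:
`∫ φ(f₀) ∏_{i ∈ u} φ(fᵢ) dμ = Σ_{i ∈ u} C_T(f₀, fᵢ) ∫ ∏_{j ∈ u, j ≠ i} φ(f_j) dμ`.
[cite: Janson1997, Thm 1.28] -/
theorem integral_linObs_mul_prod_linObs (hω : 0 < ω₂) (hT : 0 < T)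
    (hμ : (pinnedChain ω₂ 0 0 γ).IsChainGibbsMeasure T μ) (hS : IsShiftInvariant μ)
    {ι : Type} [DecidableEq ι] (u : Finset ι) (f₀ : TestFn) (f : ι → TestFn) :
    ∫ σ, linObs f₀ σ * ∏ i ∈ u, linObs (f i) σ ∂μ =
      ∑ i ∈ u, thermalCov ω₂ T f₀ (f i) * ∫ σ, ∏ j ∈ u.erase i, linObs (f j) σ ∂μ := by
  have hPi : (fun σ : ChainConfig => ∏ i ∈ u, linObs (f i) σ) ∈
      (Algebra.adjoin ℝ (Set.range (fun xc : ℤ × Bool => fun σ : ChainConfig => if xc.2 then (σ xc.1).2 else (σ xc.1).1))) := prod_linObs_mem_localPolynomials u f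
  have hIq : ∀ x, Integrable (fun σ : ChainConfig => (σ x).1 * ∏ i ∈ u, linObs (f i) σ) μ := fun x =>
    integrable_of_mem_localPolynomials hω hT hμ hS
      (mul_mem_localPolynomials (position_mem_localPolynomials x) hPi)
  have hIp : ∀ x, Integrable (fun σ : ChainConfig => (σ x).2 * ∏ i ∈ u, linObs (f i) σ) μ := fun x =>
    integrable_of_mem_localPolynomials hω hT hμ hS
      (mul_mem_localPolynomials (momentum_mem_localPolynomials x) hPi)
  have hexp : ∀ σ, linObs f₀ σ * ∏ i ∈ u, linObs (f i) σ =
      ∑ x ∈ f₀.1.support, f₀.1 x * ((σ x).1 * ∏ i ∈ u, linObs (f i) σ) +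
        ∑ x ∈ f₀.2.support, f₀.2 x * ((σ x).2 * ∏ i ∈ u, linObs (f i) σ) := by
    intro σ
    rw [linObs_eq_sum, add_mul, Finset.sum_mul, Finset.sum_mul]
    congr 1 <;> exact Finset.sum_congr rfl fun x _ => by ring
  simp_rw [hexp]
  rw [integral_add (integrable_finsetSum _ fun x _ => (hIq x).const_mul _)
    (integrable_finsetSum _ fun x _ => (hIp x).const_mul _),
    integral_finsetSum _ (fun x _ => (hIq x).const_mul _),
    integral_finsetSum _ (fun x _ => (hIp x).const_mul _)]
  simp_rw [integral_const_mul, integral_fst_mul_prod_linObs hω hT hμ hS _ u f,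
    integral_snd_mul_prod_linObs hω hT hμ hS _ u f, thermalCov_eq_sum]
  exact sum_letters_regroup u f₀.1.support f₀.2.support f₀.1 f₀.2
    (fun x i => ∑ y ∈ (f i).1.support, (f i).1 y * greenFn ω₂ (x - y)) (fun x i => (f i).2 x)
    (fun i => ∫ σ, ∏ j ∈ u.erase i, linObs (f j) σ ∂μ) T

/-- **STUB K1** (L): Stein/Isserlis recursion for the shift-invariant DLR state of the harmonic chain.
For `ω₂ > 0`, `T > 0` and every shift-invariant DLR state `μ` of `pinnedChain ω₂ 0 0 γ` at
temperature `T`: (i) all products of linear local observables `φ(f) = Σ_x (f^q_x q_x + f^p_x p_x)`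
are integrable; (ii) `∫ φ(f₀) dμ = 0`; (iii) Stein's recursion
`∫ φ(f₀) ∏ᵢ φ(fᵢ) dμ = Σᵢ C_T(f₀, fᵢ) ∫ ∏_{j ≠ i} φ(f_j) dμ` with the thermal covariance
`C_T = thermalCov ω₂ T` — the mixed moments are the Isserlis–Wick moments of the centred Gaussian
with covariance `C_T` (one-site DLR factorisation of the momenta, the Schwinger–Dyson identity of
stub S, the lattice equation `(ω₂ − Δ)G = δ₀` of the Green function and bounded uniqueness).
[cite: Janson1997, Thm 1.28 (Wick/Isserlis)] [cite: LanfordLebowitzLieb1977, §4 remark (ii)] -/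
theorem stub_harmonicStein :
  ∀ ω₂ γ T : ℝ, 0 < ω₂ → 0 < T → ∀ μ : MeasureTheory.Measure ChainConfig,
    (pinnedChain ω₂ 0 0 γ).IsChainGibbsMeasure T μ → IsShiftInvariant μ →
      (∀ (N : ℕ) (f : Fin N → TestFn), MeasureTheory.Integrable (fun σ : ChainConfig => ∏ i, linObs (f i) σ) μ) ∧
      (∀ f₀ : TestFn, ∫ σ, linObs f₀ σ ∂μ = 0) ∧
      (∀ (N : ℕ) (f₀ : TestFn) (f : Fin (N + 1) → TestFn),
          ∫ σ, linObs f₀ σ * ∏ i, linObs (f i) σ ∂μ =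
            ∑ i : Fin (N + 1), thermalCov ω₂ T f₀ (f i) * ∫ σ, ∏ j : Fin N, linObs (Fin.removeNth i f j) σ ∂μ) := by
  intro ω₂ γ T hω hT μ hμ hS
  refine ⟨fun N f => integrable_of_mem_localPolynomials hω hT hμ hS
    (prod_linObs_mem_localPolynomials Finset.univ f), fun f₀ => ?_, fun N f₀ f => ?_⟩
  · have h := integral_linObs_mul_prod_linObs hω hT hμ hS (∅ : Finset (Fin 0)) f₀ (fun _ => f₀)
    simpa using h
  · rw [integral_linObs_mul_prod_linObs hω hT hμ hS Finset.univ f₀ f]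
    refine Finset.sum_congr rfl fun i _ => ?_
    congr 1
    refine integral_congr_ae (Eventually.of_forall fun σ => ?_)
    exact prod_univ_erase_eq_prod_succAbove (fun j => linObs (f j) σ) i

end AssemblyFinal

end Summit.AtomisticToContinuum.FouriersLaw.Theorems.DrudeDissolution.GramPencilHarmonicChaos

end
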